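import Literature.NumberTheory.Automorphic.LanglandsTunnellReduction
import Literature.NumberTheory.Automorphic.LanglandsTunnellModThree
import Literature.NumberTheory.GaloisRepresentations.ArtinCharacterReciprocityProofs
import Literature.NumberTheory.Automorphic.TunnellOctahedralGlobalProofs
import Literature.NumberTheory.Automorphic.PiOfArtinRepFrobSatakeCompatibleProofs
import Literature.NumberTheory.GaloisRepresentations.GL2F3Lift
import Mathlib.GroupTheory.SpecificGroups.Cyclic
import Mathlib.GroupTheory.Index
import HarnessLib

/-!
# Stub-ideation k = 2, GENERATION 10 (home family 2 — RESHAPE) for `stub_modThree`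

Companion of `STUB-IDEAS-stub_modThree-2.md` (gen 10).  Nothing registered; the stub statement is
copied verbatim as `SigStubModThree`.

* `stubModThree_of_open_leaves` (R1, carried from gens 8–9, PROVED): the typed stub from the eight
  currently OPEN leaves of the tree's Langlands–Tunnell decomposition — the stub's exact trust base
  (re-probed 2026-08-31T22:32Z: still 0 unconditional `_holds` among the eight).
* Two further RESHAPE doors, closed by small certificates on `G = GL₂(𝔽₃)` and its lift
  `Ψ = GL2F3Lift.psi` (brute-force companion `scratch/gl23_cone.py` in the seat folder):
  - **T3 (generating function / converse theorem ⇒ Hecke L-functions via induction theorems).**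
    `B3a`–`B3c`: every subgroup of index `≤ 4` is non-abelian (centraliser bound `≤ 8` off `±1`),
    hence `Res_H Ψ` has no stable line for `[G:H] ≤ 4`, hence (Frobenius reciprocity) no monomial
    character `Ind_H^G λ` is a multiple of `χ_Ψ`, hence (irreducibility) `χ_Ψ` is not a non-negative
    rational combination of monomial characters — in `G` and, by `N`-invariants, in every finite
    `G' ↠ G`.  So `L(s, σ ⊗ ψ)^m` is never a product of Hecke L-functions with exponents `≥ 0`:
    the converse-theorem input — k3 g7's hypothesis `ArtinHolomorphyModThree`, fed to the tree's
    Booker facts `booker_strongArtin_of_artinConjecture` /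
    `bookerKrishnamurthy_isPiOfArtinRep_of_entire_twists` — has no supply from induction theorems;
    its only supply in the tree is Langlands–Tunnell itself.
  - **T4 (change the order of induction: go UP only through subnormal cyclic towers, Arthur–Clozel
    1989 Prop. 7.2).**  `B4s`: every proper subnormal subgroup lies in `SL₂(𝔽₃) = ker det` (from the
    gen-9 normal-closure lemma `B0`), so every `ℤ`-combination of `Ind_{Γ₀}^G χ` (`Γ₀` subnormal,
    `χ` abelian) is CONSTANT on `det⁻¹(-1)`; `B4c`: `tr Ψ` is not (`tr Ψ(d) ≠ tr Ψ(g₈)`), so `χ_Ψ`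
    is outside the Arthur–Clozel span (rank 5 of 8; its `(-1)`-central part is the line through
    `Ind_{C₄}^G φ = Ψ ⊕ Ψ⊗sgn ⊕ 2·Ind_B(1 ⊠ sgn)`).  `B4`/`B4n`: the cheapest monomialisation of
    `Ψ` has index `3` and is NOT normal (the 2-Sylow `SD₁₆` ↔ the cubic field `ℚ(∛Δ_E)`), the
    cheapest normal one has index `6` (`Q₈` ↔ `ℚ(ζ₃, ∛Δ_E)`): the automorphic-induction road must
    descend along a non-normal cubic (JPSS 1981 = leaf `tunnell_cuspidal_cubic_lifts`) or along
    `C₃` then `C₂` with fibre-pinning (leaves `cuspidal_descent_cyclic`,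
    `exists_cuspidal_descent_det_cubic`, `ArthurClozel_fibres_quadratic`, `GelbartJacquet_adjoint_lift`).
  All `B`-lemmas are NEGATIVE knowledge (road-closure certificates): they enter no assembly.
-/

noncomputable section

open scoped MatrixGroups NumberField
open Literature.NumberTheory.EllipticCurves
open Literature.NumberTheory.Automorphic
open Literature.NumberTheory.GaloisRepresentations
open WeierstrassCurve

set_option linter.dupNamespace false

namespace Summit.ABC.ABC.Cruxes.FreyModularity.StubModThreeIdeasK2G10

/-- The registered stub statement, verbatim. -/
def SigStubModThree : Prop :=
  ∀ (W : WeierstrassCurve ℚ) [W.IsElliptic] (ρ : ModPGaloisRep ℚ (ZMod 3) 2),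
    W.IsTorsionGaloisRep 3 ρ → FramedRep.IsAbsolutelyIrreducible ρ → ρ.IsModular

/-! ## R1 (carried, PROVED) — the stub from the eight OPEN leaves -/

/-- **R1.** The typed stub from the eight open leaves of `langlands_tunnell_of_leaves`; the three
discharged leaves are fed by their `_holds` theorems. -/
theorem stubModThree_of_open_leaves
    (hAI : automorphicInduction_character)
    (hdesc3 : exists_cuspidal_descent_det_cubic) (hGJ : GelbartJacquet_adjoint_lift)
    (hJS : JacquetShalika_eq_of_rsData_eq) (hdesc : cuspidal_descent_cyclic)
    (ha : ArthurClozel_fibres_quadratic) (hb : tunnell_cuspidal_cubic_lifts)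
    (hW1 : exists_isNewform1_of_isPiOfArtinRep) : SigStubModThree :=
  fun W _ ρ hρ habs ↦
    W.isModular_of_isTorsionGaloisRep_three_of_langlands_tunnell
      (langlands_tunnell_of_leaves artinReciprocity_character_holds hAI hdesc3 hGJ hJS hdesc
        exists_twist_quadraticSign_holds ha hb frobSatakeCompatibleAt_of_isPiOfArtinRep_holds hW1)
      ρ hρ habs

/-! ## Explicit elements of `GL₂(𝔽₃)` -/

/-- `d = diag(1,-1)`: the image of complex conjugation under an odd `ρ̄` (up to conjugacy). -/
def dConj : GL (Fin 2) (ZMod 3) :=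
  Matrix.GeneralLinearGroup.mkOfDetNeZero !![1, 0; 0, -1] (by decide)

/-- `g₈ = (1 1; 2 1)`: determinant `-1`, trace `-1`, order `8` (a generator of a non-split Cartan
`𝔽₉ˣ ⊂ GL₂(𝔽₃)`). -/
def gEight : GL (Fin 2) (ZMod 3) :=
  Matrix.GeneralLinearGroup.mkOfDetNeZero !![1, 1; 2, 1] (by decide)

/-- `g₈⁴ = -1` (so `g₈` has order `8`). Kernel-checked. -/
theorem gEight_pow_four : gEight * gEight * gEight * gEight = -1 := by
  decide

/-- `det d ≠ 1` and `det g₈ ≠ 1` (both lie in `det⁻¹(-1)`). Kernel-checked. -/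
theorem det_dConj_ne_one_and_det_gEight_ne_one :
    Matrix.GeneralLinearGroup.det dConj ≠ 1 ∧ Matrix.GeneralLinearGroup.det gEight ≠ 1 := by
  decide

/-- The traces of `d` and `g₈` differ in `𝔽₃` (`0` versus `-1`). Kernel-checked. -/
theorem trace_dConj_ne_trace_gEight :
    Matrix.trace (dConj : Matrix (Fin 2) (Fin 2) (ZMod 3)) ≠
      Matrix.trace (gEight : Matrix (Fin 2) (Fin 2) (ZMod 3)) := by
  decide

/-! ## T3 certificates: no Hecke / Brauer road (positive monomial cone excludes `χ_Ψ`) -/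

/-- **B3a (S, decidable size).** Centralisers of non-central elements of `GL₂(𝔽₃)` have order
`≤ 8` (tori `C₈`, `C₆ = Z·U`, `D₈ ∩ …`); hence every abelian subgroup has order `≤ 8`. -/
theorem B3a_card_centralizer_le :
    ∀ g : GL (Fin 2) (ZMod 3), g ≠ 1 → g ≠ -1 →
      Nat.card (Subgroup.centralizer ({g} : Set (GL (Fin 2) (ZMod 3)))) ≤ 8 := by
  sorry

/-- **B3b (S).** Every subgroup of index `≤ 4` (order `≥ 12`: the Borels, the 2-Sylows `SD₁₆`,
`SL₂(𝔽₃)`, `G`) is non-abelian.  From `B3a` and Cauchy, or from the gen-9 lemma `B0′`. -/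
theorem B3b_not_comm_of_index_le_four :
    ∀ H : Subgroup (GL (Fin 2) (ZMod 3)), H.index ≤ 4 → ∃ x ∈ H, ∃ y ∈ H, x * y ≠ y * x := by
  sorry

/-- **B3c (M).** For `[G:H] ≤ 4` the restriction of the lift `Ψ` to `H` has no stable line
(`Res_H Ψ` irreducible: `Ψ` is faithful, `GL2F3Lift.psi_injective`, and `Ψ(H)` is non-abelian by
`B3b`; a `2`-dimensional representation of a finite group with a stable line is a sum of two
characters, i.e. has abelian image).  With Frobenius reciprocity this is
"no `Ind_H^G λ` is a multiple of `χ_Ψ`", whence `χ_Ψ ∉ ℚ_{≥0}`-cone of monomial characters. -/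
theorem B3c_no_stable_line_of_index_le_four :
    ∀ H : Subgroup (GL (Fin 2) (ZMod 3)), H.index ≤ 4 →
      ∀ v : Fin 2 → ℂ, v ≠ 0 →
        ∃ h ∈ H, ∀ a : ℂ, ((GL2F3Lift.psi h : GL (Fin 2) ℂ) : Matrix (Fin 2) (Fin 2) ℂ).mulVec v ≠ a • v := by
  sorry

/-! ## T4 certificates: the automorphic-induction road must DESCEND (non-normal cubic or C₃∘C₂) -/

/-- **B4 (S–M).** Every subgroup of index `≥ 3` (i.e. not containing `SL₂(𝔽₃)`) has a CYCLIC
subgroup of index `≤ 2` — so `Res_H Ψ` is reducible or monomial exactly when `[G:H] ≥ 3`; the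
minimum `3` is attained only at the three (conjugate, non-normal) 2-Sylow subgroups `SD₁₆ ⊃ C₈`. -/
theorem B4_exists_cyclic_relindex_le_two :
    ∀ H : Subgroup (GL (Fin 2) (ZMod 3)), 3 ≤ H.index →
      ∃ A : Subgroup (GL (Fin 2) (ZMod 3)), A ≤ H ∧ A.relIndex H ≤ 2 ∧ IsCyclic A := by
  sorry

/-- **B4n (S).** A normal subgroup of `GL₂(𝔽₃)` of index `≥ 3` has index `≥ 6` (normal
subgroups: `1, {±1}, Q₈, SL₂(𝔽₃), G`, indices `48, 24, 6, 2, 1`): the cheapest GALOIS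
monomialisation of `Ψ ∘ ρ̄` is over the `S₃`-field `ℚ(ζ₃, ∛Δ_E)`. -/
theorem B4n_six_le_index_of_normal :
    ∀ H : Subgroup (GL (Fin 2) (ZMod 3)), H.Normal → 3 ≤ H.index → 6 ≤ H.index := by
  sorry

/-- **B4s (S, from the gen-9 normal-closure lemma `B0`).** Every member of a subnormal chain
`H₁ ◁ H₂ ◁ H₃ ◁ G` is `G` itself or lies in `SL₂(𝔽₃) = ker det`; consequently every
`Ind_{Γ₀}^G χ` with `Γ₀` proper subnormal VANISHES on `det⁻¹(-1)`, and the Arthur–Clozel span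
(Prop. 7.2 of Arthur–Clozel 1989: `ℤ`-span of such inductions) consists of class functions that
are constant on `det⁻¹(-1)`. -/
theorem B4s_subnormal_le_ker_det :
    ∀ H₁ H₂ H₃ : Subgroup (GL (Fin 2) (ZMod 3)), H₃.Normal → (H₂.subgroupOf H₃).Normal →
      (H₁.subgroupOf H₂).Normal → H₁ ≤ H₂ → H₂ ≤ H₃ →
        H₁ = ⊤ ∨ ∀ g ∈ H₁, Matrix.GeneralLinearGroup.det g = 1 := by
  sorry

/-- `tr Ψ̃(g) ≡ tr g (mod 𝔭 = (1 + √-2))`, from `GL2F3Lift.map_redHom_lift`.  (Used for B4c: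
`tr Ψ(d) ≠ tr Ψ(g₈)` although both `d, g₈ ∈ det⁻¹(-1)`, so `χ_Ψ` is outside the Arthur–Clozel span
of `B4s` — and stays outside after inflation to any finite `G' ↠ GL₂(𝔽₃)`, by `N`-invariants.) -/
theorem redHom_trace_lift (g : GL (Fin 2) (ZMod 3)) :
    GL2F3Lift.redHom (Matrix.trace (GL2F3Lift.lift g)) =
      Matrix.trace (g : Matrix (Fin 2) (Fin 2) (ZMod 3)) := by
  rw [AddMonoidHom.map_trace, GL2F3Lift.map_redHom_lift]

/-- **B4c (PROVED).** `tr Ψ̃(d) ≠ tr Ψ̃(g₈)`: the lift's character is not constant on `det⁻¹(-1)`. -/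
theorem B4c_trace_lift_dConj_ne_trace_lift_gEight :
    Matrix.trace (GL2F3Lift.lift dConj) ≠ Matrix.trace (GL2F3Lift.lift gEight) := by
  intro h
  apply trace_dConj_ne_trace_gEight
  rw [← redHom_trace_lift dConj, ← redHom_trace_lift gEight, h]

end Summit.ABC.ABC.Cruxes.FreyModularity.StubModThreeIdeasK2G10
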